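import Mathlib
import HarnessLib
import Literature.Computability.AlgebraicComplexity.PatternExpressions
import Summits.ValiantsHypothesis.ValiantsHypothesis.Theorems.MonotoneRestorationMonotoneRestorationQPLinearWidthDefs
import Summits.ValiantsHypothesis.ValiantsHypothesis.Theorems.MonotoneRestorationMonotoneRestorationQPLinearWidthKroneckerMonotonicity
import Summits.ValiantsHypothesis.ValiantsHypothesis.Theorems.MonotoneRestorationMonotoneRestorationQPLinearWidthKroneckerNarrow
import Summits.ValiantsHypothesis.ValiantsHypothesis.Theorems.MonotoneRestorationMonotoneRestorationQPLinearWidthLevelDownward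
import Summits.ValiantsHypothesis.ValiantsHypothesis.Theorems.MonotoneRestorationOrbitRestorationQPHomSpanAdmissible
import Summits.ValiantsHypothesis.ValiantsHypothesis.Theorems.MonotoneRestorationOrbitRestorationQPPerNotNarrow

/-!
# Route MonotoneRestoration, crux `MonotoneRestorationQP` (stmt-15886), line `linear_width` —
# KRONECKER ISOLATION AT EVERY LEVEL (no factorisation of the level) AND THE NON-ISOMORPHIC EXPANSION BRIDGE

Helper file (`--supports stmt-ValiantsHypothesis-15886`), def-free.

The weighted monotonicity theorem `KroneckerMonotonicity.coeff_mul_sub_eval_eq_zero_of_determined` (p840674) isolates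
every pattern of a determined hom expansion at a PRODUCT level `N = m·ν` (`Fin N ≃ Fin m × Fin ν`).  With the
level-downward monotonicity `LevelDownward.determined_levelRestrict_le` (p840846: determinedness descends along
zero-extension to every smaller level) the factorisation constraint disappears: isolation holds at EVERY level `N` for
every `ν` with `m·ν ≤ N`.  The second ingredient g11's census asked for is the BRIDGE from the tree's spanning theorem
`HomSpan.mem_span_admissible_of_matrixSymmetric` to an expansion over PAIRWISE NON-ISOMORPHIC admissible patterns (index
the expansion by the distinct POLYNOMIALS of a finitely supported combination; isomorphic patterns have equal
homomorphism polynomials, `HomPolyBasics.homPoly_map_equiv`).  Together: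

* `exists_sum_of_mem_span` — a member of a span is a `C`-linear combination of DISTINCT generators;
* `exists_nonIso_expansion_of_matrixSymmetric` — **THE BRIDGE**: every matrix-symmetric `p ∈ ℂ[x_ij : i, j < n]` is
  `Σ_i α_i hom_{F_i,n}` over pairwise non-isomorphic, isolated-vertex-free patterns `F_i` with `≤ min(deg p, n)`
  vertices a side and `≤ deg p` edges (so DPS26 Lemma 8.18 `HomExpansionUnique.homPoly_linearIndependent` applies);
* `coeff_mul_sub_eval_eq_zero_of_determined_le`, `eval_homPoly_eq_of_determined_le_of_coeff_ne_zero` —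
  **ISOLATION AT EVERY LEVEL**: if `Σ_i α_i hom_{F_i,N}` (pairwise non-isomorphic, isolated-vertex-free, `≤ m` vertices a
  side) is determined by `HomIndist N k` and `m·ν ≤ N`, then `α_i·(hom_{F_i,ν}(z) − hom_{F_i,ν}(z')) = 0` for every
  `HomIndist ν k` pair `z, z'`;
* `mem_narrowSpan_of_determined_of_distinguishable_le` — DETERMINED ⇒ NARROW with no loss of width, at every level, for
  expansions whose wide patterns are distinguished at some level `ν ≤ N/m`;
* `qpOrbit_of_matrixSymmetric_of_smallDistinguishable` — **THE FACTORISATION-FREE CONDITIONAL RUNG**: a matrix-symmetric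
  family `f`, determined at width `(log₂ N + c)^c` at every level `N` (the node `PolylogHomDetermined`, unfolded), such
  that at every level some `ν` with `deg(f_N)·ν ≤ N` DISTINGUISHES every isolated-vertex-free pattern with `≤ deg f_N`
  vertices a side and treewidth `≥ (log₂ N + c)^c` by a `HomIndist ν ((log₂ N + c)^c)` pair, has square-symmetric
  circuits of orbit size `≤ 2^((log₂ N + c + 3)^(c+3))`.  The expansion is no longer a hypothesis (the bridge), the
  level is arbitrary (no `Fin N ≃ Fin m × Fin ν`), `VP` is idle; the ONLY input is the small-level distinguishability —
  (W1) of the census KRONECKER-MONOTONICITY-g11.md for degrees `N/(log N)^{ω(1)}·…`; at LINEAR degree the hypothesis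
  `deg(f_N)·ν ≤ N` forces `ν ≤ 1/c`, i.e. the rung itself is exactly the (GIANT) residue.

Honest label: composition of landed pieces; conditional on the distinguishability input; no stub closed; the rung, the
cruxes and VP ≠ VNP are NOT moved.
[cite: DawarPagoSeppelt2025, Thm 7.9, Thm 7.11, §7.1.1; DwivediPagoSeppelt2026, Lemma 8.18; DawarWilsenach2025, §3.3]
-/

set_option linter.dupNamespace false

noncomputable section

open scoped Classical

namespace Summit.ValiantsHypothesis.ValiantsHypothesis.Theorems.IsolationAnyLevel

open MvPolynomial Finset
open Literature.Computability.AlgebraicComplexity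
open Summit.ValiantsHypothesis.ValiantsHypothesis.Theorems.MonotoneRestorationQPLinearWidth
open Summit.ValiantsHypothesis.ValiantsHypothesis.Theorems.KroneckerMonotonicity
open Summit.ValiantsHypothesis.ValiantsHypothesis.Theorems.LevelDownward

variable {n : ℕ}

/-! ### The non-isomorphic expansion bridge -/

/-- A member of the span of a set of polynomials is a `C`-linear combination of finitely many DISTINCT members of the
set (the support of a finitely supported combination, enumerated). [folklore] -/
theorem exists_sum_of_mem_span {S : Set (MvPolynomial (Fin n × Fin n) ℂ)} {p : MvPolynomial (Fin n × Fin n) ℂ}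
    (hp : p ∈ Submodule.span ℂ S) :
    ∃ (M : ℕ) (q : Fin M → MvPolynomial (Fin n × Fin n) ℂ) (α : Fin M → ℂ),
      Function.Injective q ∧ (∀ i, q i ∈ S) ∧ p = ∑ i, C (α i) * q i := by
  obtain ⟨c, hcS, hcp⟩ := Submodule.mem_span_set.1 hp
  refine ⟨c.support.card, fun i => ((c.support.equivFin.symm i : c.support) : MvPolynomial (Fin n × Fin n) ℂ),
    fun i => c (c.support.equivFin.symm i), ?_, fun i => hcS (c.support.equivFin.symm i).2, ?_⟩
  · intro i j hij
    exact c.support.equivFin.symm.injective (Subtype.val_injective hij)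
  · rw [← hcp, Finsupp.sum, ← Finset.sum_coe_sort]
    exact Fintype.sum_equiv c.support.equivFin _ _ fun x => by simp [smul_eq_C_mul]

/-- **THE NON-ISOMORPHIC EXPANSION BRIDGE.**  Every matrix-symmetric polynomial `p` on the `n × n` variable matrix is a
linear combination `Σ_i α_i hom_{F_i,n}` of homomorphism polynomials of PAIRWISE NON-ISOMORPHIC bipartite patterns
`F_i` without isolated vertices, with at most `min(deg p, n)` vertices on each side and at most `deg p` edges — the
hypotheses under which the expansion is unique (Dwivedi–Pago–Seppelt 2026, Lemma 8.18).
[cite: DwivediPagoSeppelt2026, §8 (Lemma 8.18)] -/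
theorem exists_nonIso_expansion_of_matrixSymmetric (p : MvPolynomial (Fin n × Fin n) ℂ)
    (hp : ∀ σ τ : Equiv.Perm (Fin n), rename (fun ij : Fin n × Fin n => (σ ij.1, τ ij.2)) p = p) :
    ∃ (M : ℕ) (a b : Fin M → ℕ) (E : (i : Fin M) → Multiset (Fin (a i) × Fin (b i))) (α : Fin M → ℂ),
      (∀ i, a i ≤ n ∧ b i ≤ n) ∧ (∀ i, a i ≤ p.totalDegree ∧ b i ≤ p.totalDegree) ∧
      (∀ i, Multiset.card (E i) ≤ p.totalDegree) ∧
      (∀ i (u : Fin (a i)), ∃ x ∈ E i, x.1 = u) ∧ (∀ i (v : Fin (b i)), ∃ x ∈ E i, x.2 = v) ∧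
      (∀ i j, i ≠ j → ∀ (ea : Fin (a i) ≃ Fin (a j)) (eb : Fin (b i) ≃ Fin (b j)),
        ((E i).map fun x => (ea x.1, eb x.2)) ≠ E j) ∧
      p = ∑ i, C (α i) * homPoly (E i) n ℂ := by
  obtain ⟨M, q, α, hinj, hqS, hpq⟩ := exists_sum_of_mem_span (HomSpan.mem_span_admissible_of_matrixSymmetric p hp)
  choose a b E ha hb had hbd hEd hrow hcol hqE using hqS
  refine ⟨M, a, b, E, α, fun i => ⟨ha i, hb i⟩, fun i => ⟨had i, hbd i⟩, hEd, hrow, hcol, ?_, ?_⟩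
  · intro i j hij ea eb heq
    apply hij
    apply hinj
    rw [hqE i, hqE j, ← heq, HomPolyBasics.homPoly_map_equiv]
  · rw [hpq]
    exact Finset.sum_congr rfl fun i _ => by rw [hqE i]

/-! ### Kronecker isolation at every level -/

/-- **ISOLATION AT EVERY LEVEL.**  Let `p^{(ℓ)} = Σ_i α_i hom_{F_i,ℓ}` over pairwise non-isomorphic isolated-vertex-free
patterns with at most `m` vertices a side.  If `p^{(N)}` is determined by `HomIndist N k` and `m·ν ≤ N`, then for every
pair `z, z' ∈ ℂ^{ν×ν}` with `HomIndist ν k z z'` and every `i`: `α_i · (hom_{F_i,ν}(z) − hom_{F_i,ν}(z')) = 0`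
(descend to the level `m·ν` by zero-extension, then isolate by the Kronecker congruence).
[cite: DawarPagoSeppelt2025, Thm 7.11 (Claim 3), §7.1.1] -/
theorem coeff_mul_sub_eval_eq_zero_of_determined_le {N m ν k M : ℕ} (hle : m * ν ≤ N)
    (a b : Fin M → ℕ) (E : (i : Fin M) → Multiset (Fin (a i) × Fin (b i))) (α : Fin M → ℂ)
    (hm : ∀ i, a i ≤ m ∧ b i ≤ m)
    (hrow : ∀ i (u : Fin (a i)), ∃ x ∈ E i, x.1 = u)
    (hcol : ∀ i (v : Fin (b i)), ∃ x ∈ E i, x.2 = v)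
    (hiso : ∀ i j, i ≠ j → ∀ (ea : Fin (a i) ≃ Fin (a j)) (eb : Fin (b i) ≃ Fin (b j)),
      ((E i).map fun x => (ea x.1, eb x.2)) ≠ E j)
    (hdet : ∀ A B : Fin N × Fin N → ℂ, HomIndist N k A B →
      eval A (∑ i, C (α i) * homPoly (E i) N ℂ) = eval B (∑ i, C (α i) * homPoly (E i) N ℂ))
    {z z' : Fin ν × Fin ν → ℂ} (h : HomIndist ν k z z') (i : Fin M) :
    α i * (eval z (homPoly (E i) ν ℂ) - eval z' (homPoly (E i) ν ℂ)) = 0 := by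
  have hdet' : ∀ A B : Fin (m * ν) × Fin (m * ν) → ℂ, HomIndist (m * ν) k A B →
      eval A (∑ i, C (α i) * homPoly (E i) (m * ν) ℂ) = eval B (∑ i, C (α i) * homPoly (E i) (m * ν) ℂ) :=
    fun A B hAB => determined_levelRestrict_le hle a b E α hrow hcol hdet hAB
  exact coeff_mul_sub_eval_eq_zero_of_determined finProdFinEquiv.symm a b E α hm hrow hcol hiso hdet' h i

/-- **Every pattern with a nonzero coefficient in a determined expansion is determined at every level `ν ≤ N/m`.**
[cite: DawarPagoSeppelt2025, §7.1.1, Thm 7.11] -/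
theorem eval_homPoly_eq_of_determined_le_of_coeff_ne_zero {N m ν k M : ℕ} (hle : m * ν ≤ N)
    (a b : Fin M → ℕ) (E : (i : Fin M) → Multiset (Fin (a i) × Fin (b i))) (α : Fin M → ℂ)
    (hm : ∀ i, a i ≤ m ∧ b i ≤ m)
    (hrow : ∀ i (u : Fin (a i)), ∃ x ∈ E i, x.1 = u)
    (hcol : ∀ i (v : Fin (b i)), ∃ x ∈ E i, x.2 = v)
    (hiso : ∀ i j, i ≠ j → ∀ (ea : Fin (a i) ≃ Fin (a j)) (eb : Fin (b i) ≃ Fin (b j)),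
      ((E i).map fun x => (ea x.1, eb x.2)) ≠ E j)
    (hdet : ∀ A B : Fin N × Fin N → ℂ, HomIndist N k A B →
      eval A (∑ i, C (α i) * homPoly (E i) N ℂ) = eval B (∑ i, C (α i) * homPoly (E i) N ℂ))
    {i : Fin M} (hi : α i ≠ 0) {z z' : Fin ν × Fin ν → ℂ} (h : HomIndist ν k z z') :
    eval z (homPoly (E i) ν ℂ) = eval z' (homPoly (E i) ν ℂ) := by
  have h0 := coeff_mul_sub_eval_eq_zero_of_determined_le hle a b E α hm hrow hcol hiso hdet h i
  rcases mul_eq_zero.1 h0 with h1 | h1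
  · exact absurd h1 hi
  · exact sub_eq_zero.1 h1

/-- **DETERMINED ⇒ NARROW at every level, for expansions whose wide patterns are distinguished at a small level.**
If `Σ_i α_i hom_{F_i,N}` (pairwise non-isomorphic, isolated-vertex-free, `≤ m` vertices a side) is determined by
`HomIndist N k`, `m·ν ≤ N`, and every `F_i` of treewidth `≥ k` is distinguished by some `HomIndist ν k` pair, then the
combination lies in the span of the `hom_{F,N}` with `tw F < k`. [cite: DawarPagoSeppelt2025, Thm 7.9, §7.1.1] -/
theorem mem_narrowSpan_of_determined_of_distinguishable_le {N m ν k M : ℕ} (hle : m * ν ≤ N)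
    (a b : Fin M → ℕ) (E : (i : Fin M) → Multiset (Fin (a i) × Fin (b i))) (α : Fin M → ℂ)
    (hm : ∀ i, a i ≤ m ∧ b i ≤ m)
    (hrow : ∀ i (u : Fin (a i)), ∃ x ∈ E i, x.1 = u)
    (hcol : ∀ i (v : Fin (b i)), ∃ x ∈ E i, x.2 = v)
    (hiso : ∀ i j, i ≠ j → ∀ (ea : Fin (a i) ≃ Fin (a j)) (eb : Fin (b i) ≃ Fin (b j)),
      ((E i).map fun x => (ea x.1, eb x.2)) ≠ E j)
    (hdet : ∀ A B : Fin N × Fin N → ℂ, HomIndist N k A B →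
      eval A (∑ i, C (α i) * homPoly (E i) N ℂ) = eval B (∑ i, C (α i) * homPoly (E i) N ℂ))
    (hdist : ∀ i, k ≤ Literature.Combinatorics.SimpleGraph.treewidth (patternGraph (E i)) →
      ∃ z z' : Fin ν × Fin ν → ℂ, HomIndist ν k z z' ∧ eval z (homPoly (E i) ν ℂ) ≠ eval z' (homPoly (E i) ν ℂ)) :
    (∑ i, C (α i) * homPoly (E i) N ℂ) ∈ Submodule.span ℂ
      {q : MvPolynomial (Fin N × Fin N) ℂ | ∃ (a b : ℕ) (E : Multiset (Fin a × Fin b)),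
        Literature.Combinatorics.SimpleGraph.treewidth
            (SimpleGraph.fromRel fun u v : Fin a ⊕ Fin b => ∃ e ∈ E, u = Sum.inl e.1 ∧ v = Sum.inr e.2) < k ∧
          q = homPoly E N ℂ} := by
  refine Submodule.sum_mem _ fun i _ => ?_
  by_cases hi : α i = 0
  · rw [hi, C_0, zero_mul]
    exact Submodule.zero_mem _
  · have htw : Literature.Combinatorics.SimpleGraph.treewidth (patternGraph (E i)) < k := by
      by_contra hge
      obtain ⟨z, z', hzz, hne⟩ := hdist i (not_lt.1 hge)
      exact hne (eval_homPoly_eq_of_determined_le_of_coeff_ne_zero hle a b E α hm hrow hcol hiso hdet hi hzz)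
    rw [← smul_eq_C_mul]
    exact Submodule.smul_mem _ _ (Submodule.subset_span ⟨a i, b i, E i, htw, rfl⟩)

/-! ### The factorisation-free conditional rung -/

/-- **THE FACTORISATION-FREE CONDITIONAL RUNG (weighted currency).**  Let `f` be a MATRIX-SYMMETRIC family which is
determined at width `(log₂ N + c)^c` at every level `N` (the node `PolylogHomDetermined` of line `linear_width`,
unfolded), and suppose that at every level `N` some level `ν` with `deg(f_N)·ν ≤ N` DISTINGUISHES every bipartite pattern
without isolated vertices, with `≤ deg f_N` vertices a side and treewidth `≥ (log₂ N + c)^c`, by a pair of points of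
`ℂ^{ν×ν}` hom-indistinguishable below that treewidth.  Then every `f_N` has a square-symmetric circuit of orbit size
`≤ 2^((log₂ N + c + 3)^(c+3))`.  (The expansion comes from the bridge, the isolation from
`mem_narrowSpan_of_determined_of_distinguishable_le`, the circuit from K2/K3 `qpOrbit_of_mem_narrowSpan`; `VP` and the
degree budget enter only through the distinguishability input.)
[cite: DawarPagoSeppelt2025, Thm 7.9, §7.1.1; DawarWilsenach2025, §3.3; DwivediPagoSeppelt2026, Lemma 8.18] -/
theorem qpOrbit_of_matrixSymmetric_of_smallDistinguishable (f : (n : ℕ) → MvPolynomial (Fin n × Fin n) ℂ) (c : ℕ)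
    (hsym : ∀ (n : ℕ) (σ τ : Equiv.Perm (Fin n)),
      rename (fun ij : Fin n × Fin n => (σ ij.1, τ ij.2)) (f n) = f n)
    (hf : ∀ (n : ℕ) (A B : Fin n × Fin n → ℂ), HomIndist n ((Nat.log 2 n + c) ^ c) A B →
      eval A (f n) = eval B (f n))
    (hdist : ∀ N : ℕ, ∃ ν : ℕ, (f N).totalDegree * ν ≤ N ∧
      ∀ (a b : ℕ) (E : Multiset (Fin a × Fin b)), a ≤ (f N).totalDegree → b ≤ (f N).totalDegree →
        (∀ u : Fin a, ∃ x ∈ E, x.1 = u) → (∀ v : Fin b, ∃ x ∈ E, x.2 = v) →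
        (Nat.log 2 N + c) ^ c ≤ Literature.Combinatorics.SimpleGraph.treewidth (patternGraph E) →
        ∃ z z' : Fin ν × Fin ν → ℂ, HomIndist ν ((Nat.log 2 N + c) ^ c) z z' ∧
          eval z (homPoly E ν ℂ) ≠ eval z' (homPoly E ν ℂ))
    (N : ℕ) :
    ∃ (G : Type) (_ : Fintype G) (C : LabelledArithCircuit ℂ (Fin N × Fin N) Unit G),
      C.IsSymmetric (Equiv.Perm (Fin N)) ∧ C.eval (C.output ()) = f N ∧
        C.orbitSize (Equiv.Perm (Fin N)) ≤ 2 ^ ((Nat.log 2 N + (c + 3)) ^ (c + 3)) := by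
  refine OrbitRestorationQPHomPolyClose.qpOrbit_of_mem_narrowSpan f c (fun n => ?_) N
  obtain ⟨M, a, b, E, α, -, hdeg, -, hrow, hcol, hiso, hfe⟩ :=
    exists_nonIso_expansion_of_matrixSymmetric (f n) (hsym n)
  obtain ⟨ν, hν, hdν⟩ := hdist n
  have hdet : ∀ A B : Fin n × Fin n → ℂ, HomIndist n ((Nat.log 2 n + c) ^ c) A B →
      eval A (∑ i, C (α i) * homPoly (E i) n ℂ) = eval B (∑ i, C (α i) * homPoly (E i) n ℂ) := by
    intro A B hAB
    rw [← hfe]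
    exact hf n A B hAB
  have hmem := mem_narrowSpan_of_determined_of_distinguishable_le hν a b E α hdeg hrow hcol hiso hdet
    fun i hk => hdν (a i) (b i) (E i) (hdeg i).1 (hdeg i).2 (hrow i) (hcol i) hk
  rw [hfe]
  refine Submodule.span_mono ?_ hmem
  rintro q ⟨a', b', E', htw, rfl⟩
  exact ⟨a', b', E', htw.le, rfl⟩

/-! ### Two widths: indistinguishability below `k`, treewidth cut at `K ≥ k` (appended) -/

/-- **DETERMINED ⇒ NARROW, two-width form.**  As `mem_narrowSpan_of_determined_of_distinguishable_le`, but the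
distinguishing pairs are hom-indistinguishable below the SMALL width `k` (the width of determinedness) while only the
patterns of treewidth `≥ K` (a possibly LARGER cut, e.g. `K = poly(k)` from a polynomial grid-minor bound) are required
to be distinguished; the conclusion is narrowness at width `K`.  This is the shape in which the small-witness
homomorphism-distinguishing closedness input (W1) comes in print: `tw F ≥ poly(k)` ⇒ `F` has a `k × k` grid minor ⇒ a
CFI pair over the grid, `C^k`-equivalent, of size `poly(k)`, distinguishes `F`. [cite: DawarPagoSeppelt2025, Thm 7.3, Thm 7.9, §7.1.1] -/
theorem mem_narrowSpan_of_determined_of_distinguishable₂ {N m ν k K M : ℕ} (hle : m * ν ≤ N)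
    (a b : Fin M → ℕ) (E : (i : Fin M) → Multiset (Fin (a i) × Fin (b i))) (α : Fin M → ℂ)
    (hm : ∀ i, a i ≤ m ∧ b i ≤ m)
    (hrow : ∀ i (u : Fin (a i)), ∃ x ∈ E i, x.1 = u)
    (hcol : ∀ i (v : Fin (b i)), ∃ x ∈ E i, x.2 = v)
    (hiso : ∀ i j, i ≠ j → ∀ (ea : Fin (a i) ≃ Fin (a j)) (eb : Fin (b i) ≃ Fin (b j)),
      ((E i).map fun x => (ea x.1, eb x.2)) ≠ E j)
    (hdet : ∀ A B : Fin N × Fin N → ℂ, HomIndist N k A B →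
      eval A (∑ i, C (α i) * homPoly (E i) N ℂ) = eval B (∑ i, C (α i) * homPoly (E i) N ℂ))
    (hdist : ∀ i, K ≤ Literature.Combinatorics.SimpleGraph.treewidth (patternGraph (E i)) →
      ∃ z z' : Fin ν × Fin ν → ℂ, HomIndist ν k z z' ∧ eval z (homPoly (E i) ν ℂ) ≠ eval z' (homPoly (E i) ν ℂ)) :
    (∑ i, C (α i) * homPoly (E i) N ℂ) ∈ Submodule.span ℂ
      {q : MvPolynomial (Fin N × Fin N) ℂ | ∃ (a b : ℕ) (E : Multiset (Fin a × Fin b)),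
        Literature.Combinatorics.SimpleGraph.treewidth
            (SimpleGraph.fromRel fun u v : Fin a ⊕ Fin b => ∃ e ∈ E, u = Sum.inl e.1 ∧ v = Sum.inr e.2) < K ∧
          q = homPoly E N ℂ} := by
  refine Submodule.sum_mem _ fun i _ => ?_
  by_cases hi : α i = 0
  · rw [hi, C_0, zero_mul]
    exact Submodule.zero_mem _
  · have htw : Literature.Combinatorics.SimpleGraph.treewidth (patternGraph (E i)) < K := by
      by_contra hge
      obtain ⟨z, z', hzz, hne⟩ := hdist i (not_lt.1 hge)
      exact hne (eval_homPoly_eq_of_determined_le_of_coeff_ne_zero hle a b E α hm hrow hcol hiso hdet hi hzz)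
    rw [← smul_eq_C_mul]
    exact Submodule.smul_mem _ _ (Submodule.subset_span ⟨a i, b i, E i, htw, rfl⟩)

/-- **THE FACTORISATION-FREE CONDITIONAL RUNG, two-width form.**  A matrix-symmetric family determined at width
`(log₂ N + c)^c` at every level, such that at every level `N` some `ν` with `deg(f_N)·ν ≤ N` distinguishes — by pairs
hom-indistinguishable below `(log₂ N + c)^c` — every isolated-vertex-free pattern with `≤ deg f_N` vertices a side and
treewidth `≥ (log₂ N + c')^{c'}` (a second, possibly larger polylogarithmic cut), has square-symmetric circuits of orbit
size `≤ 2^((log₂ N + c' + 3)^(c'+3))`. [cite: DawarPagoSeppelt2025, Thm 7.3, Thm 7.9, §7.1.1; DawarWilsenach2025, §3.3] -/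
theorem qpOrbit_of_matrixSymmetric_of_smallDistinguishable₂ (f : (n : ℕ) → MvPolynomial (Fin n × Fin n) ℂ)
    (c c' : ℕ)
    (hsym : ∀ (n : ℕ) (σ τ : Equiv.Perm (Fin n)),
      rename (fun ij : Fin n × Fin n => (σ ij.1, τ ij.2)) (f n) = f n)
    (hf : ∀ (n : ℕ) (A B : Fin n × Fin n → ℂ), HomIndist n ((Nat.log 2 n + c) ^ c) A B →
      eval A (f n) = eval B (f n))
    (hdist : ∀ N : ℕ, ∃ ν : ℕ, (f N).totalDegree * ν ≤ N ∧
      ∀ (a b : ℕ) (E : Multiset (Fin a × Fin b)), a ≤ (f N).totalDegree → b ≤ (f N).totalDegree →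
        (∀ u : Fin a, ∃ x ∈ E, x.1 = u) → (∀ v : Fin b, ∃ x ∈ E, x.2 = v) →
        (Nat.log 2 N + c') ^ c' ≤ Literature.Combinatorics.SimpleGraph.treewidth (patternGraph E) →
        ∃ z z' : Fin ν × Fin ν → ℂ, HomIndist ν ((Nat.log 2 N + c) ^ c) z z' ∧
          eval z (homPoly E ν ℂ) ≠ eval z' (homPoly E ν ℂ))
    (N : ℕ) :
    ∃ (G : Type) (_ : Fintype G) (C : LabelledArithCircuit ℂ (Fin N × Fin N) Unit G),
      C.IsSymmetric (Equiv.Perm (Fin N)) ∧ C.eval (C.output ()) = f N ∧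
        C.orbitSize (Equiv.Perm (Fin N)) ≤ 2 ^ ((Nat.log 2 N + (c' + 3)) ^ (c' + 3)) := by
  refine OrbitRestorationQPHomPolyClose.qpOrbit_of_mem_narrowSpan f c' (fun n => ?_) N
  obtain ⟨M, a, b, E, α, -, hdeg, -, hrow, hcol, hiso, hfe⟩ :=
    exists_nonIso_expansion_of_matrixSymmetric (f n) (hsym n)
  obtain ⟨ν, hν, hdν⟩ := hdist n
  have hdet : ∀ A B : Fin n × Fin n → ℂ, HomIndist n ((Nat.log 2 n + c) ^ c) A B →
      eval A (∑ i, C (α i) * homPoly (E i) n ℂ) = eval B (∑ i, C (α i) * homPoly (E i) n ℂ) := by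
    intro A B hAB
    rw [← hfe]
    exact hf n A B hAB
  have hmem := mem_narrowSpan_of_determined_of_distinguishable₂ (K := (Nat.log 2 n + c') ^ c') hν a b E α hdeg
    hrow hcol hiso hdet fun i hk => hdν (a i) (b i) (E i) (hdeg i).1 (hdeg i).2 (hrow i) (hcol i) hk
  rw [hfe]
  refine Submodule.span_mono ?_ hmem
  rintro q ⟨a', b', E', htw, rfl⟩
  exact ⟨a', b', E', htw.le, rfl⟩

end Summit.ValiantsHypothesis.ValiantsHypothesis.Theorems.IsolationAnyLevel

end
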